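import Mathlib.Analysis.Convex.Contractible
import Literature.Analysis.Complex.HolomorphicPrimitives
import Literature.Analysis.Complex.RiemannMapping
import HarnessLib

/-!
# Plane domains without holes are simply connected (Conway VIII.2.2, (c) ⇒ (a))

Let `G ⊆ ℂ` be open and connected. If no connected component of `ℂ \ G` is bounded (for open
`G` this is Conway's condition VIII.2.2 (c) "`ℂ∞ \ G` is connected", phrased inside `ℂ`), then
`G` is simply connected. This is the implication of Conway's Theorem VIII.2.2 "which finds wide
application" (Conway, p. 204): (c) ⇒ (d) Runge ⇒ (f) primitives ⇒ (g) logarithms ⇒ (h) square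
roots (`Literature.Analysis.Complex.HolomorphicPrimitives`) ⇒ (i) `G` is homeomorphic to the
unit disc, by the Riemann mapping theorem in the form of Conway's Lemma VII.4.3
(`Complex.exists_bijOn_ball_of_hasSqrt`, `Literature.Analysis.Complex.RiemannMapping`), or
`G = ℂ` ⇒ (a) `G` is simply connected (homeomorphism invariance; the disc is convex).

In particular (`Complex.isSimplyConnected_of_isConnected_compl`) a bounded connected open set
with connected complement — e.g. the inner domain of a Jordan curve — is simply connected; this is
how `Literature/Probability/RandomPlanarGeometry/JordanDomainProofs.lean` discharges
`Literature.Probability.RandomPlanarGeometry.JordanDomain.isSimplyConnected` without the Jordan–Schoenflies theorem.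

## Main results

* `Complex.hasSqrt_of_compl`: hole-free connected open sets have the square-root property.
* `Complex.isSimplyConnected_of_bijOn_ball`: Conway VIII.2.2, (i) ⇒ (a).
* `Complex.isSimplyConnected_of_hasSqrt`: Conway VIII.2.2, (h) ⇒ (a).
* `Complex.isSimplyConnected_of_compl`: Conway VIII.2.2, (c) ⇒ (a).
* `Complex.isSimplyConnected_of_isConnected_compl`: bounded connected open sets with connected
  complement are simply connected.
* `Complex.isPreconnected_compl_of_frontier`, `Complex.isSimplyConnected_of_isPreconnected_frontier`:
  an open set with connected frontier has connected complement; hence bounded domains with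
  connected boundary (e.g. Jordan domains) are simply connected.

## Mathlib

We USE `IsSimplyConnected` / `SimplyConnectedSpace`, `Convex.contractibleSpace`,
`ContinuousMap.HomotopyEquiv.simplyConnectedSpace_iff` (via `Homeomorph.toHomotopyEquiv`; the
homeomorphism `U ≃ₜ 𝔻` is assembled inside `isSimplyConnected_of_bijOn_ball` from
`Set.BijOn.invOn_invFunOn` and `ContinuousOn.mapsToRestrict`), `connectedComponentIn`,
`IsOpen.connectedComponentIn` (components of open sets are open in the locally connected `ℂ`).

## References

* J. B. Conway, *Functions of One Complex Variable I*, 2nd ed., GTM 11, Springer (1978),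
  Thm. VIII.2.2 and Lemma VII.4.3 (pp. 202–204, 160–162).
* W. Rudin, *Real and Complex Analysis*, 3rd ed. (1987), Thm. 13.11.
-/

noncomputable section

open Set Filter Topology Metric Bornology

namespace Complex

variable {G : Set ℂ}

/-- **Hole-free connected open sets have the square-root property** (Conway VIII.2.2,
(c) ⇒ (h)): repackaging of `Complex.exists_sq_eq_of_compl`. [cite: Conway1978, Ch. VIII Thm. 2.2 ((c)⇒(h))] -/
theorem hasSqrt_of_compl (hG : IsOpen G) (hGc : IsPreconnected G)
    (hGh : ∀ a ∈ Gᶜ, ¬ IsBounded (connectedComponentIn Gᶜ a)) : HasSqrt G :=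
  fun _ hf hf0 ↦ exists_sq_eq_of_compl hG hGc hGh hf hf0

/-- The open unit disc is simply connected (it is convex). [folklore] -/
theorem isSimplyConnected_ball : IsSimplyConnected (ball (0 : ℂ) 1) := by
  have : ContractibleSpace (ball (0 : ℂ) 1) :=
    (convex_ball (0 : ℂ) 1).contractibleSpace ⟨0, mem_ball_self one_pos⟩
  change SimplyConnectedSpace (ball (0 : ℂ) 1)
  infer_instance

/-- **Conway VIII.2.2, (i) ⇒ (a)**: a subset of `ℂ` homeomorphic to the unit disc — here via a
bijection `f : U → 𝔻` continuous on `U` with continuous inverse — is simply connected. Conway,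
*Functions of One Complex Variable I* (1978), Thm. VIII.2.2. [cite: Conway1978, Ch. VIII Thm. 2.2 ((i)⇒(a))] -/
theorem isSimplyConnected_of_bijOn_ball {U : Set ℂ} {f : ℂ → ℂ} (hf : ContinuousOn f U)
    (hbij : BijOn f U (ball 0 1)) (hinv : ContinuousOn (Function.invFunOn f U) (ball 0 1)) :
    IsSimplyConnected U := by
  -- the homeomorphism `U ≃ₜ 𝔻` induced by `f` and `Function.invFunOn f U`
  let e : U ≃ₜ ball (0 : ℂ) 1 :=
    { toFun := hbij.mapsTo.restrict f U (ball 0 1)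
      invFun := hbij.surjOn.mapsTo_invFunOn.restrict (Function.invFunOn f U) (ball 0 1) U
      left_inv := fun a ↦ Subtype.ext (hbij.invOn_invFunOn.1 a.2)
      right_inv := fun b ↦ Subtype.ext (hbij.invOn_invFunOn.2 b.2)
      continuous_toFun := hf.mapsToRestrict _
      continuous_invFun := hinv.mapsToRestrict _ }
  have hball : SimplyConnectedSpace (ball (0 : ℂ) 1) := isSimplyConnected_ball
  change SimplyConnectedSpace U
  exact e.toHomotopyEquiv.simplyConnectedSpace_iff.2 hball

/-- **Conway VIII.2.2, (h) ⇒ (a)**: a connected open set `G ⊆ ℂ` on which every zero-free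
holomorphic function has a holomorphic square root is simply connected. If `G = ℂ` this is
convexity; otherwise Conway's Lemma VII.4.3 (`Complex.exists_bijOn_ball_of_hasSqrt`) maps `G`
biholomorphically onto the unit disc. Conway, *Functions of One Complex Variable I* (1978),
Thm. VIII.2.2 ((h) ⇒ (i) ⇒ (a)). [cite: Conway1978, Ch. VIII Thm. 2.2 ((h)⇒(a))] -/
theorem isSimplyConnected_of_hasSqrt (hG : IsOpen G) (hGc : IsConnected G) (hsq : HasSqrt G) :
    IsSimplyConnected G := by
  by_cases hG' : G = univ
  · subst hG'
    have : ContractibleSpace (univ : Set ℂ) := convex_univ.contractibleSpace ⟨0, mem_univ _⟩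
    change SimplyConnectedSpace (univ : Set ℂ)
    infer_instance
  · obtain ⟨z₀, hz₀⟩ := hGc.nonempty
    obtain ⟨f, hfd, hbij, -, -, hinv⟩ :=
      exists_bijOn_ball_of_hasSqrt hG hGc.isPreconnected hsq hG' hz₀
    exact isSimplyConnected_of_bijOn_ball hfd.continuousOn hbij hinv.continuousOn

/-- **Plane domains without holes are simply connected** (Conway VIII.2.2, (c) ⇒ (a)): if
`G ⊆ ℂ` is open and connected and no connected component of `ℂ \ G` is bounded, then `G` is
simply connected. Conway, *Functions of One Complex Variable I* (1978), Thm. VIII.2.2; Rudin,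
*Real and Complex Analysis*, Thm. 13.11 ((d) ⇒ (b)). [cite: Conway1978, Ch. VIII Thm. 2.2 ((c)⇒(a))] -/
theorem isSimplyConnected_of_compl (hG : IsOpen G) (hGc : IsConnected G)
    (hGh : ∀ a ∈ Gᶜ, ¬ IsBounded (connectedComponentIn Gᶜ a)) : IsSimplyConnected G :=
  isSimplyConnected_of_hasSqrt hG hGc (hasSqrt_of_compl hG hGc.isPreconnected hGh)

/-- **Bounded plane domains with connected complement are simply connected**: if `G ⊆ ℂ` is
open, connected and bounded and `ℂ \ G` is connected, then `G` is simply connected (the single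
component `ℂ \ G` of the complement is unbounded because `G` is bounded). Conway (1978),
Thm. VIII.2.2 ((c) ⇒ (a)). [cite: Conway1978, Ch. VIII Thm. 2.2 ((c)⇒(a))] -/
theorem isSimplyConnected_of_isConnected_compl (hG : IsOpen G) (hGc : IsConnected G)
    (hGb : IsBounded G) (hcompl : IsPreconnected Gᶜ) : IsSimplyConnected G := by
  refine isSimplyConnected_of_compl hG hGc fun a ha hb ↦ ?_
  have hsub : Gᶜ ⊆ connectedComponentIn Gᶜ a := hcompl.subset_connectedComponentIn ha subset_rfl
  have huniv : IsBounded (univ : Set ℂ) := by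
    rw [← union_compl_self G]
    exact hGb.union (hb.subset hsub)
  exact NormedSpace.unbounded_univ ℝ ℂ huniv

/-! ### Complements of open sets with connected frontier -/

/-- **An open set with connected boundary has connected complement.** Let `G ⊆ ℂ` be open with
`∂G` (pre)connected. Then `ℂ \ G` is preconnected: `ℂ \ G = ∂G ∪ E` with `E = ℂ \ Ḡ` open, and for
each `x ∈ E` the closure of the component `C_x` of `x` in `E` meets `∂G` (otherwise `C_x` would be
clopen in `ℂ`), so `ℂ \ G = ⋃ₓ (∂G ∪ closure C_x)` is a union of connected sets through `∂G`.
(Used for Jordan domains: the frontier is a Jordan curve, in particular connected.) [folklore] -/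
theorem isPreconnected_compl_of_frontier (hG : IsOpen G) (hJ : IsPreconnected (frontier G)) :
    IsPreconnected Gᶜ := by
  rcases G.eq_empty_or_nonempty with rfl | hGne
  · simpa using isPreconnected_univ
  set J := frontier G with hJdef
  set E := (closure G)ᶜ with hEdef
  have hE : IsOpen E := isClosed_closure.isOpen_compl
  have hGJ : Gᶜ = J ∪ E := by
    ext z
    simp only [mem_compl_iff, mem_union, hJdef, hEdef, frontier, Set.mem_sdiff, hG.interior_eq]
    constructor
    · intro hz
      by_cases h : z ∈ closure G
      · exact Or.inl ⟨h, hz⟩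
      · exact Or.inr h
    · rintro (⟨-, hz⟩ | hz)
      · exact hz
      · exact fun hzG ↦ hz (subset_closure hzG)
  have hEG : ∀ z ∈ E, z ∉ G := fun z hz hzG ↦ hz (subset_closure hzG)
  -- the closure of each component of `E` meets `J`
  have hmeet : ∀ x ∈ E, (closure (connectedComponentIn E x) ∩ J).Nonempty := by
    intro x hx
    by_contra h
    rw [not_nonempty_iff_eq_empty] at h
    set C := connectedComponentIn E x with hC
    have hCo : IsOpen C := hE.connectedComponentIn
    have hclE : closure C ⊆ E := by
      intro z hz
      have hzG : z ∈ Gᶜ := by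
        have : closure C ⊆ Gᶜ :=
          closure_minimal ((connectedComponentIn_subset _ _).trans fun w hw ↦ hEG w hw)
            hG.isClosed_compl
        exact this hz
      rw [hGJ] at hzG
      rcases hzG with hzJ | hzE
      · exact absurd (show z ∈ closure C ∩ J from ⟨hz, hzJ⟩) (by rw [h]; exact id)
      · exact hzE
    have hcl : closure C ⊆ C :=
      isPreconnected_connectedComponentIn.closure.subset_connectedComponentIn
        (subset_closure (mem_connectedComponentIn hx)) hclE
    have hCc : IsClosed C := closure_subset_iff_isClosed.1 hcl
    have hCuniv : C = univ := IsClopen.eq_univ ⟨hCc, hCo⟩ ⟨x, mem_connectedComponentIn hx⟩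
    obtain ⟨g, hg⟩ := hGne
    have hgC : g ∈ C := by rw [hCuniv]; exact mem_univ g
    exact hEG g (connectedComponentIn_subset E x hgC) hg
  -- the connected pieces
  set S : ℂ → Set ℂ := fun x ↦ J ∪ closure (connectedComponentIn E x) with hSdef
  have hSc : ∀ x, IsPreconnected (S x) := by
    intro x
    by_cases hx : x ∈ E
    · obtain ⟨j, hjC, hjJ⟩ := hmeet x hx
      exact IsPreconnected.union j hjJ hjC hJ isPreconnected_connectedComponentIn.closure
    · simp only [hSdef, connectedComponentIn_eq_empty hx, closure_empty, union_empty]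
      exact hJ
  have hSsub : ∀ x, S x ⊆ Gᶜ := by
    intro x
    refine union_subset (fun z hz ↦ ?_) ?_
    · rw [hGJ]; exact Or.inl hz
    · exact closure_minimal ((connectedComponentIn_subset _ _).trans fun w hw ↦ hEG w hw)
        hG.isClosed_compl
  rcases (E : Set ℂ).eq_empty_or_nonempty with hEe | ⟨x₀, hx₀⟩
  · rw [hGJ, hEe, union_empty]
    exact hJ
  obtain ⟨j₀, -, hj₀⟩ := hmeet x₀ hx₀
  have hj₀S : ∀ x, j₀ ∈ S x := fun x ↦ Or.inl hj₀
  have key : IsPreconnected (⋃ x, S x) := isPreconnected_iUnion ⟨j₀, mem_iInter.2 hj₀S⟩ hSc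
  convert key using 1
  refine subset_antisymm (fun z hz ↦ ?_) (iUnion_subset hSsub)
  rw [hGJ] at hz
  rcases hz with hz | hz
  · exact mem_iUnion.2 ⟨z, Or.inl hz⟩
  · exact mem_iUnion.2 ⟨z, Or.inr (subset_closure (mem_connectedComponentIn hz))⟩

/-- **Bounded domains with connected boundary are simply connected**: an open, connected, bounded
`G ⊆ ℂ` whose frontier is preconnected (e.g. a Jordan curve) is simply connected. Conway (1978),
Thm. VIII.2.2 ((c) ⇒ (a)), with `isPreconnected_compl_of_frontier`. [cite: Conway1978, Ch. VIII Thm. 2.2 ((c)⇒(a))] -/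
theorem isSimplyConnected_of_isPreconnected_frontier (hG : IsOpen G) (hGc : IsConnected G)
    (hGb : IsBounded G) (hJ : IsPreconnected (frontier G)) : IsSimplyConnected G :=
  isSimplyConnected_of_isConnected_compl hG hGc hGb (isPreconnected_compl_of_frontier hG hJ)

end Complex

end
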